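import Literature.AnabelianGeometry.AbsoluteAnabelian.ProfiniteTerminology
import Literature.NumberTheory.GaloisRepresentations.AbsGaloisGroup
import Literature.NumberTheory.GaloisRepresentations.CohomologicalDimension
import Mathlib.FieldTheory.Galois.Infinite
import Mathlib.FieldTheory.KrullTopology
import Mathlib.GroupTheory.Schreier
import Mathlib.Topology.Algebra.OpenSubgroup
import HarnessLib

/-!
# Open subgroups of `Gal(K̄/K)` as absolute Galois groups of finite subextensions, and
# topological finite generation under transport — tools for [AbsAnab] §1.1

S. Mochizuki, *The Absolute Anabelian Geometry of Hyperbolic Curves* (2004) [AbsAnab], §1.1,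
proof of Lemma 1.1.4 p. 7: "Denote by `K′` the finite extension of `F_𝔭` determined by `G′`"
— the tacit identification of an open subgroup `G′ ⊆ G_K` with the absolute Galois group of its
fixed field, used throughout §1 (Thm 1.1.1, Lemma 1.1.4 (i)/(ii), Prop 1.2.1 (iv)).  This file
supplies it, in the tree's vocabulary, for every field `K` of characteristic `0`:

* `exists_intermediateField_of_isOpen_absoluteGaloisGroup`: an open subgroup of
  `Field.absoluteGaloisGroup K` is `Gal(K̄/E)` for a finite subextension `E ⊆ K̄`, Galois when the
  subgroup is normal (Mathlib's fundamental theorem of infinite Galois theory, repackaged);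
* `nonempty_continuousMulEquiv_fixingSubgroup`: `Gal(K̄/E) ≅ G_E := Gal(Ē/E)` as topological
  groups (`K̄` is an algebraic closure of `E`; the trunk's
  `algEquivContinuousMulEquivAbsoluteGaloisGroup` of `CohomologicalDimension.lean` plus the
  continuity of restriction of scalars);
* `IsTopologicallyFinitelyGenerated.of_surjective`, `.of_continuousMulEquiv`,
  `.subgroup_isOpen`: topological finite generation ([AbsTopI] §0 / `ProfiniteTerminology.lean`)
  passes to images under continuous surjections and to open subgroups of compact groups
  (Schreier's lemma).

Proof-only (no definitions).  Reference for the Galois theory: Neukirch, *Algebraic Number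
Theory*, Ch. IV §1, (1.1)–(1.2).
-/

noncomputable section

namespace Literature.AnabelianGeometry.AbsoluteAnabelian

open Field
open Literature.NumberTheory.GaloisRepresentations

universe u v

/-! ### Topological finite generation under transport -/

section TFG

variable {G : Type u} [Group G] [TopologicalSpace G] [IsTopologicalGroup G]
variable {H : Type v} [Group H] [TopologicalSpace H] [IsTopologicalGroup H]

/-- Topological finite generation passes to the image of a continuous surjective homomorphism
(the image of a dense finitely generated subgroup is dense and finitely generated).
[cite: MochizukiAbsTopI2012, §0 p.8] -/
theorem IsTopologicallyFinitelyGenerated.of_surjective (f : G →ₜ* H)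
    (hf : Function.Surjective f) (h : IsTopologicallyFinitelyGenerated G) :
    IsTopologicallyFinitelyGenerated H := by
  classical
  obtain ⟨s, hs⟩ := h.exists_finset
  refine ⟨⟨s.image f, ?_⟩⟩
  rw [Finset.coe_image]
  change (Subgroup.closure (f.toMonoidHom '' (s : Set G))).topologicalClosure = ⊤
  rw [← MonoidHom.map_closure]
  exact DenseRange.topologicalClosure_map_subgroup (f := f.toMonoidHom) (map_continuous f)
    hf.denseRange hs

/-- Topological finite generation is invariant under bicontinuous isomorphisms.
[cite: MochizukiAbsTopI2012, §0 p.8] -/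
theorem IsTopologicallyFinitelyGenerated.of_continuousMulEquiv (e : G ≃ₜ* H)
    (h : IsTopologicallyFinitelyGenerated G) : IsTopologicallyFinitelyGenerated H :=
  h.of_surjective ⟨e.toMulEquiv.toMonoidHom, map_continuous e⟩ e.surjective

omit [TopologicalSpace H] [IsTopologicalGroup H] in
/-- An open subgroup of a compact topologically finitely generated group is topologically
finitely generated: a dense finitely generated subgroup `Λ` meets the open subgroup `U` in a
subgroup of finite index in `Λ` — finitely generated by Schreier's lemma — which is dense in
`U`. [cite: MochizukiAbsTopI2012, §0 p.8] -/
theorem IsTopologicallyFinitelyGenerated.subgroup_isOpen [CompactSpace G]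
    (h : IsTopologicallyFinitelyGenerated G) (U : Subgroup G) (hU : IsOpen (U : Set G)) :
    IsTopologicallyFinitelyGenerated U := by
  classical
  obtain ⟨s, hs⟩ := h.exists_finset
  set Λ : Subgroup G := Subgroup.closure (s : Set G) with hΛ
  -- `U ∩ Λ` has finite index in the finitely generated group `Λ`, hence is finitely generated
  haveI : Finite (G ⧸ U) := Subgroup.quotient_finite_of_isOpen U hU
  haveI : U.FiniteIndex := Subgroup.finiteIndex_of_finite_quotient
  haveI : Group.FG Λ := Group.closure_finset_fg s
  haveI : Group.FG ↥(U.subgroupOf Λ) := Subgroup.fg_of_index_ne_zero _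
  obtain ⟨t, ht⟩ := Group.fg_def.mp (inferInstance : Group.FG ↥(U.subgroupOf Λ))
  -- push the generators into `U`
  let ι : ↥(U.subgroupOf Λ) →* G := Λ.subtype.comp (U.subgroupOf Λ).subtype
  have hιU : ∀ x : ↥(U.subgroupOf Λ), ι x ∈ U := fun x => x.2
  let j : ↥(U.subgroupOf Λ) →* U :=
    { toFun := fun x => ⟨ι x, hιU x⟩
      map_one' := by ext; simp [ι]
      map_mul' := fun x y => by ext; simp [ι] }
  have hj : U.subtype.comp j = ι := by ext; rfl
  refine ⟨⟨t.image j, ?_⟩⟩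
  -- the generated subgroup of `U`, pushed to `G`, is `Λ ∩ U`
  have hmap : (Subgroup.closure ((t.image j : Finset U) : Set U)).map U.subtype = Λ ⊓ U := by
    rw [Finset.coe_image, ← MonoidHom.map_closure, Subgroup.map_map, hj, ht,
      ← MonoidHom.range_eq_map]
    change (Λ.subtype.comp (U.subgroupOf Λ).subtype).range = Λ ⊓ U
    rw [MonoidHom.range_comp, Subgroup.range_subtype, Subgroup.subgroupOf_map_subtype, inf_comm]
  -- density: `U ⊆ closure (U ∩ Λ)` since `Λ` is dense and `U` is open
  have hdense : Dense (Λ : Set G) := by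
    rw [dense_iff_closure_eq, ← Subgroup.topologicalClosure_coe, hs, Subgroup.coe_top]
  rw [eq_top_iff]
  rintro u -
  change u ∈ closure ((Subgroup.closure ((t.image j : Finset U) : Set U) : Subgroup U) : Set U)
  rw [closure_subtype, ← Subgroup.coe_subtype, ← Subgroup.coe_map, hmap, Subgroup.coe_inf,
    Set.inter_comm]
  exact hdense.open_subset_closure_inter hU u.2

end TFG

/-! ### Open subgroups of the absolute Galois group -/

section Galois

variable (K : Type) [Field K] [CharZero K]

/-- Infinite Galois theory for `K̄/K` (`char K = 0`): an open subgroup `N` of `Gal(K̄/K)` is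
`Gal(K̄/E)` for a finite subextension `E` (its fixed field); if `N` is normal, `E/K` is Galois.
[cite: MochizukiAbsAnab2004, Lemma 1.1.4 proof p.7] -/
theorem exists_intermediateField_of_isOpen_absoluteGaloisGroup (N : Subgroup (absoluteGaloisGroup K))
    (hN : IsOpen (N : Set (absoluteGaloisGroup K))) :
    ∃ E : IntermediateField K (AlgebraicClosure K), FiniteDimensional K E ∧
      (N.Normal → IsGalois K E) ∧
      E.fixingSubgroup.comap (absoluteGaloisGroup.toAlgEquiv K).toMonoidHom = N := by
  have hc : IsClosed (N : Set (absoluteGaloisGroup K)) := N.isClosed_of_isOpen hN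
  -- `Field.absoluteGaloisGroup K` is `K̄ ≃ₐ[K] K̄` with the Krull topology
  let N' : ClosedSubgroup (AlgebraicClosure K ≃ₐ[K] AlgebraicClosure K) :=
    ⟨(N : Subgroup (AlgebraicClosure K ≃ₐ[K] AlgebraicClosure K)), hc⟩
  have hfix : (IntermediateField.fixedField N'.1).fixingSubgroup = N'.1 :=
    InfiniteGalois.fixingSubgroup_fixedField N'
  refine ⟨IntermediateField.fixedField N'.1, ?_, ?_, ?_⟩
  · rw [← InfiniteGalois.isOpen_iff_finite, hfix]
    exact hN
  · intro hNn
    rw [← InfiniteGalois.normal_iff_isGalois, hfix]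
    exact hNn
  · rw [hfix]
    ext σ
    exact Iff.rfl

omit [CharZero K] in
/-- Restriction of scalars `Gal(K̄/E) → Gal(K̄/K)`, `E ⊆ K̄` a subextension, is continuous for
the Krull topologies. [folklore] -/
private theorem continuous_restrictScalars (E : IntermediateField K (AlgebraicClosure K)) :
    Continuous (fun σ : AlgebraicClosure K ≃ₐ[E] AlgebraicClosure K =>
      (σ.restrictScalars K : AlgebraicClosure K ≃ₐ[K] AlgebraicClosure K)) := by
  let φ : (AlgebraicClosure K ≃ₐ[E] AlgebraicClosure K) →*
      (AlgebraicClosure K ≃ₐ[K] AlgebraicClosure K) :=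
    { toFun := fun σ => σ.restrictScalars K
      map_one' := rfl
      map_mul' := fun _ _ => rfl }
  change Continuous φ
  apply continuous_of_continuousAt_one φ (continuousAt_def.mpr _)
  intro N hN
  rw [map_one] at hN
  obtain ⟨M, _, hM⟩ := (krullTopology_mem_nhds_one_iff K (AlgebraicClosure K) N).mp hN
  let b := Module.finBasis K M
  let S : Set (AlgebraicClosure K) := Set.range fun i => (b i : AlgebraicClosure K)
  let M' : IntermediateField E (AlgebraicClosure K) := IntermediateField.adjoin E S
  haveI : FiniteDimensional E M' :=
    IntermediateField.finiteDimensional_adjoin fun x _ => Algebra.IsIntegral.isIntegral x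
  refine (krullTopology_mem_nhds_one_iff E (AlgebraicClosure K) _).mpr
    ⟨M', inferInstance, fun σ hσ => hM ?_⟩
  rw [SetLike.mem_coe, IntermediateField.mem_fixingSubgroup_iff] at hσ
  rw [SetLike.mem_coe, IntermediateField.mem_fixingSubgroup_iff]
  have hb : ∀ i, φ σ (b i : AlgebraicClosure K) = b i := fun i =>
    hσ _ (IntermediateField.subset_adjoin E S ⟨i, rfl⟩)
  have key : ((φ σ).toLinearMap ∘ₗ M.val.toLinearMap) = M.val.toLinearMap :=
    b.ext fun i => hb i
  intro x hx
  exact congr($key ⟨x, hx⟩)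

/-- **`Gal(K̄/E) ≅ G_E`**: for a subextension `E ⊆ K̄` of `K` (`char K = 0`), the subgroup
`Gal(K̄/E)` of `Field.absoluteGaloisGroup K = Gal(K̄/K)` is isomorphic, as a topological group,
to the absolute Galois group `Field.absoluteGaloisGroup E = Gal(Ē/E)` (`K̄` being an algebraic
closure of `E`): "the finite extension `K′` [...] determined by `G′`", `G′ = G_{K′}`.
[cite: MochizukiAbsAnab2004, Lemma 1.1.4 proof p.7] -/
theorem nonempty_continuousMulEquiv_fixingSubgroup (E : IntermediateField K (AlgebraicClosure K)) :
    Nonempty (↥(E.fixingSubgroup.comap (absoluteGaloisGroup.toAlgEquiv K).toMonoidHom) ≃ₜ*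
      absoluteGaloisGroup E) := by
  haveI : CharZero E := charZero_of_injective_algebraMap (algebraMap K E).injective
  haveI : Algebra.IsAlgebraic E (AlgebraicClosure K) := Algebra.IsAlgebraic.tower_top (K := K) E
  haveI : IsAlgClosure E (AlgebraicClosure K) := ⟨inferInstance, inferInstance⟩
  -- `e₁ : Gal(K̄/E) ≅ G_E` (independence of the algebraic closure)
  let e₁ := algEquivContinuousMulEquivAbsoluteGaloisGroup (↥E) (AlgebraicClosure K)
  -- `ρ : Gal(K̄/E) → Gal(K̄/K)`, restriction of scalars, lands in `Gal(K̄/E) ≤ Gal(K̄/K)`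
  set N := E.fixingSubgroup.comap (absoluteGaloisGroup.toAlgEquiv K).toMonoidHom with hN
  have hmem : ∀ σ : AlgebraicClosure K ≃ₐ[E] AlgebraicClosure K,
      (absoluteGaloisGroup.toAlgEquiv K).symm (σ.restrictScalars K) ∈ N := by
    intro σ
    rw [hN, Subgroup.mem_comap]
    change absoluteGaloisGroup.toAlgEquiv K ((absoluteGaloisGroup.toAlgEquiv K).symm _) ∈ _
    rw [MulEquiv.apply_symm_apply, IntermediateField.mem_fixingSubgroup_iff]
    intro x hx
    exact σ.commutes ⟨x, hx⟩
  let ρ : (AlgebraicClosure K ≃ₐ[E] AlgebraicClosure K) →* N :=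
    { toFun := fun σ => ⟨_, hmem σ⟩
      map_one' := Subtype.ext rfl
      map_mul' := fun _ _ => Subtype.ext rfl }
  have hρcont : Continuous ρ :=
    Continuous.subtype_mk (continuous_restrictScalars K E) _
  have hρinj : Function.Injective ρ := by
    intro σ τ h
    have := congrArg (fun x : N => absoluteGaloisGroup.toAlgEquiv K (x : absoluteGaloisGroup K)) h
    exact AlgEquiv.restrictScalars_injective K this
  have hρsurj : Function.Surjective ρ := by
    intro x
    have hx : absoluteGaloisGroup.toAlgEquiv K (x : absoluteGaloisGroup K) ∈ E.fixingSubgroup := x.2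
    refine ⟨IntermediateField.fixingSubgroupEquiv E ⟨_, hx⟩, Subtype.ext ?_⟩
    change (absoluteGaloisGroup.toAlgEquiv K).symm _ = _
    rw [MulEquiv.symm_apply_eq]
    exact AlgEquiv.ext fun _ => rfl
  let hρ : (AlgebraicClosure K ≃ₐ[E] AlgebraicClosure K) ≃ₜ N :=
    Continuous.homeoOfEquivCompactToT2 (f := Equiv.ofBijective ρ ⟨hρinj, hρsurj⟩) hρcont
  let e₂ : (AlgebraicClosure K ≃ₐ[E] AlgebraicClosure K) ≃ₜ* N :=
    { MulEquiv.ofBijective ρ ⟨hρinj, hρsurj⟩ with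
      continuous_toFun := hρcont
      continuous_invFun := hρ.symm.continuous }
  exact ⟨e₂.symm.trans e₁⟩

end Galois

end Literature.AnabelianGeometry.AbsoluteAnabelian
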